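import Mathlib
import HarnessLib
import Summits.ResolutionOfSingularities.ResolutionOfSingularities.Theorems.WildQuotientsWildQuotientResolutionConductorOneAction
import Summits.ResolutionOfSingularities.ResolutionOfSingularities.Theorems.WildQuotientsWildQuotientResolutionConductorOneFrameChartMap

/-!
# S2 brick F3c-4a — the FRAME of the conductor-𝟙 core: the chart dictionary (images of `T_l`, `N_{il}`, `w_l` under
# the chart map `β_I`, and the unit identities behind `h_M⁻¹`)

(crux stmt-ResolutionOfSingularities-15640 `WildQuotients.WildQuotientResolution`, line `Sketch`; chain w45c post-V5
programme S2, design `L/res-L1-w45c-lead-1/S2-DESIGN.md` §1/§7 (7.1); res-L1-w45c-plan-1 NO OBJECTION 2026-08-27T18:26:16Z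
(F3c «dictionary»). [OURS · L1 W4.5c] — NOT a statement of any manuscript; replaces the role of no printed item;
AI-produced, weaker than expert review. Def-free, law form in `β`. Prover res-D-pv-033.)

For `β : Aₙ →ₐ[k] M_I` with `β uᵢ = s`, `β u_l = s·t_l` (`t_l = Ring.inverse (1+X_l)`, `l ∈ I∖i`), `β u_l = s·X_l·t_l` (`l ∉ I`):
* `one_add_chartX_mul_tInv` — `(1+X_l)·t_l = 1`; `beta_coreDiff` — `β(uᵢ − u_l) = s·t_l` (`l ∉ I`);
* `beta_coreFactorInv_mul` — `β(w_l)·(1 − (βu_l)^{p−1}) = 1`;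
* `chartFactor_mul_eq_one_of_mem_erase` — `(1+X_l)((1+X_l)^{p−1} − s^{p−1}) · t_l^p β(w_l) = 1` (`l ∈ I∖i`);
  `chartFactor_mul_eq_one_of_not_mem` — `(1+X_l)((1+X_l)^{p−1} − (sX_l)^{p−1}) · t_l^p β(w_l) = 1` (`l ∉ I`);
  `one_sub_pow_mul_beta_coreFactorInv` — `(1 − s^{p−1}) β(wᵢ) = 1`;
* `beta_coreT_of_mem_erase` — `β T_l = s^p · (t_l^p β w_l)`; `beta_coreT_self` — `β Tᵢ = s^p β wᵢ`;
  `beta_normDiff` — `β N_{il} = s^p · (t_l^p β(wᵢ) β(w_l))` (`l ∉ I`);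
* `chartX_mul_beta_coreU` — `X_l · β u_l = β(uᵢ − u_l)` (`l ∈ I∖i`); `chartX_mul_beta_coreDiff` —
  `X_l · β(uᵢ − u_l) = β u_l` (`l ∉ I`) (the dictionary entries of `c_l`, `e_l`).
-/

-- single-problem summit: the doubled namespace component `ResolutionOfSingularities` is forced
set_option linter.dupNamespace false

noncomputable section

open MvPolynomial

namespace Summit.ResolutionOfSingularities.ResolutionOfSingularities.Theorems.WildQuotientResolution.ConductorOne

section Base

variable (k : Type) [Field k] (p n : ℕ) (i : Fin n) (I : Finset (Fin n))
  (β : CoreRing k p n →ₐ[k] ChartRing k p n i I)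

/-- the inverse `w_l = (1 − u_l^{p−1})⁻¹` in `Aₙ` -/
local notation3 (prettyPrint := false) "cw" l => (((isUnit_coreFactor k p n l).unit⁻¹ : (CoreRing k p n)ˣ) :
  CoreRing k p n)

/-- `β(w_l) · (1 − (β u_l)^{p−1}) = 1` (`w_l = (1 − u_l^{p−1})⁻¹`). [OURS · L1 W4.5c] -/
theorem beta_coreFactorInv_mul (l : Fin n) :
    β (((isUnit_coreFactor k p n l).unit⁻¹ : (CoreRing k p n)ˣ) : CoreRing k p n) *
      (1 - β (coreU k p n l) ^ (p - 1)) = 1 := by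
  have h := (isUnit_coreFactor k p n l).unit.inv_mul
  rw [IsUnit.unit_spec] at h
  have h' := congrArg β h
  rw [map_mul, map_sub, map_pow, map_one] at h'
  exact h'

/-- `(1 − s^{p−1}) · β(wᵢ) = 1`. [OURS · L1 W4.5c] -/
theorem one_sub_pow_mul_beta_coreFactorInv (hβi : β (coreU k p n i) = chartX k p n i I i) :
    (1 - chartX k p n i I i ^ (p - 1)) * β (cw i) = 1 := by
  have h2 := beta_coreFactorInv_mul k p n i I β i
  rw [hβi] at h2
  rw [mul_comm]; exact h2

/-- `β Tᵢ = s^p · β wᵢ`. [OURS · L1 W4.5c] -/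
theorem beta_coreT_self (hβi : β (coreU k p n i) = chartX k p n i I i) :
    β (coreT k p n i) = chartX k p n i I i ^ p * β (cw i) := by
  unfold coreT
  rw [map_mul, map_pow, hβi]

end Base

section Chart

variable (k : Type) [Field k] (p n : ℕ) [Fact p.Prime] [CharP k p] (i : Fin n) (I : Finset (Fin n))

/-- the inverse `t_l = Ring.inverse (1 + X_l)` in `M_I` (a unit for `i ∈ I`) -/
local notation3 (prettyPrint := false) "tI" l => Ring.inverse (1 + chartX k p n i I l)
/-- the inverse `w_l = (1 − u_l^{p−1})⁻¹` in `Aₙ` -/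
local notation3 (prettyPrint := false) "cw" l => (((isUnit_coreFactor k p n l).unit⁻¹ : (CoreRing k p n)ˣ) :
  CoreRing k p n)

/-- `(1 + X_l) · t_l = 1`. [OURS · L1 W4.5c] -/
theorem one_add_chartX_mul_tInv (hi : i ∈ I) (l : Fin n) : (1 + chartX k p n i I l) * (tI l) = 1 :=
  Ring.mul_inverse_cancel _ (isUnit_one_add_chartX k p n i I hi l)

/-- `β(uᵢ − u_l) = s · t_l` for `l ∉ I`. [OURS · L1 W4.5c] -/
theorem beta_coreDiff (hi : i ∈ I) (β : CoreRing k p n →ₐ[k] ChartRing k p n i I)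
    (hβi : β (coreU k p n i) = chartX k p n i I i)
    (hβO : ∀ l ∉ I, β (coreU k p n l) = chartX k p n i I i * chartX k p n i I l * (tI l)) (l : Fin n)
    (hl : l ∉ I) :
    β (coreU k p n i - coreU k p n l) = chartX k p n i I i * (tI l) := by
  have h1 := one_add_chartX_mul_tInv k p n i I hi l
  rw [map_sub, hβi, hβO l hl]
  linear_combination (-(chartX k p n i I i)) * h1

/-- `(1+X_l)((1+X_l)^{p−1} − s^{p−1}) · (t_l^p β w_l) = 1` for `l ∈ I∖i`. [OURS · L1 W4.5c] -/
theorem chartFactor_mul_eq_one_of_mem_erase (hi : i ∈ I) (β : CoreRing k p n →ₐ[k] ChartRing k p n i I)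
    (hβI : ∀ l ∈ I.erase i, β (coreU k p n l) = chartX k p n i I i * (tI l)) (l : Fin n) (hl : l ∈ I.erase i) :
    ((1 + chartX k p n i I l) * ((1 + chartX k p n i I l) ^ (p - 1) - chartX k p n i I i ^ (p - 1))) *
      ((tI l) ^ p * β (cw l)) = 1 := by
  have hp0 : p ≠ 0 := (Fact.out : p.Prime).ne_zero
  have h1 := one_add_chartX_mul_tInv k p n i I hi l
  have h2 := beta_coreFactorInv_mul k p n i I β l
  rw [hβI l hl] at h2
  -- `t^p = t^{p-1} · t`, `((1+X) t)^{p-1} = 1`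
  have h3 : ((1 + chartX k p n i I l) * (tI l)) ^ (p - 1) = 1 := by rw [h1, one_pow]
  rw [← pow_sub_one_mul hp0 (tI l)]
  calc ((1 + chartX k p n i I l) * ((1 + chartX k p n i I l) ^ (p - 1) - chartX k p n i I i ^ (p - 1))) *
        ((tI l) ^ (p - 1) * (tI l) * β (cw l))
      = ((1 + chartX k p n i I l) * (tI l)) *
          ((((1 + chartX k p n i I l) * (tI l)) ^ (p - 1) - (chartX k p n i I i * (tI l)) ^ (p - 1)) *
            β (cw l)) := by
        rw [mul_pow, mul_pow]; ring
    _ = 1 := by rw [h3, h1, one_mul, mul_comm]; exact h2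

/-- `(1+X_l)((1+X_l)^{p−1} − (sX_l)^{p−1}) · (t_l^p β w_l) = 1` for `l ∉ I`. [OURS · L1 W4.5c] -/
theorem chartFactor_mul_eq_one_of_not_mem (hi : i ∈ I) (β : CoreRing k p n →ₐ[k] ChartRing k p n i I)
    (hβO : ∀ l ∉ I, β (coreU k p n l) = chartX k p n i I i * chartX k p n i I l * (tI l)) (l : Fin n)
    (hl : l ∉ I) :
    ((1 + chartX k p n i I l) *
        ((1 + chartX k p n i I l) ^ (p - 1) - (chartX k p n i I i * chartX k p n i I l) ^ (p - 1))) *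
      ((tI l) ^ p * β (cw l)) = 1 := by
  have hp0 : p ≠ 0 := (Fact.out : p.Prime).ne_zero
  have h1 := one_add_chartX_mul_tInv k p n i I hi l
  have h2 := beta_coreFactorInv_mul k p n i I β l
  rw [hβO l hl] at h2
  have h3 : ((1 + chartX k p n i I l) * (tI l)) ^ (p - 1) = 1 := by rw [h1, one_pow]
  rw [← pow_sub_one_mul hp0 (tI l)]
  calc ((1 + chartX k p n i I l) *
          ((1 + chartX k p n i I l) ^ (p - 1) - (chartX k p n i I i * chartX k p n i I l) ^ (p - 1))) *
        ((tI l) ^ (p - 1) * (tI l) * β (cw l))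
      = ((1 + chartX k p n i I l) * (tI l)) *
          ((((1 + chartX k p n i I l) * (tI l)) ^ (p - 1) -
            (chartX k p n i I i * chartX k p n i I l * (tI l)) ^ (p - 1)) * β (cw l)) := by
        rw [mul_pow, mul_pow, mul_pow]; ring
    _ = 1 := by rw [h3, h1, one_mul, mul_comm]; exact h2

omit [Fact p.Prime] [CharP k p] in
/-- `β T_l = s^p · (t_l^p β w_l)` for `l ∈ I∖i`. [OURS · L1 W4.5c] -/
theorem beta_coreT_of_mem_erase (β : CoreRing k p n →ₐ[k] ChartRing k p n i I)
    (hβI : ∀ l ∈ I.erase i, β (coreU k p n l) = chartX k p n i I i * (tI l)) (l : Fin n) (hl : l ∈ I.erase i) :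
    β (coreT k p n l) = chartX k p n i I i ^ p * ((tI l) ^ p * β (cw l)) := by
  unfold coreT
  rw [map_mul, map_pow, hβI l hl, mul_pow, mul_assoc]

/-- `β N_{il} = s^p · (t_l^p β wᵢ β w_l)` for `l ∉ I`. [OURS · L1 W4.5c] -/
theorem beta_normDiff (hi : i ∈ I) (β : CoreRing k p n →ₐ[k] ChartRing k p n i I)
    (hβi : β (coreU k p n i) = chartX k p n i I i)
    (hβO : ∀ l ∉ I, β (coreU k p n l) = chartX k p n i I i * chartX k p n i I l * (tI l)) (l : Fin n)
    (hl : l ∉ I) :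
    β ((coreU k p n i - coreU k p n l) ^ p * ((cw i) * (cw l))) =
      chartX k p n i I i ^ p * ((tI l) ^ p * (β (cw i) * β (cw l))) := by
  rw [map_mul, map_pow, beta_coreDiff k p n i I hi β hβi hβO l hl, map_mul, mul_pow, mul_assoc]

/-- The dictionary entry of `c_l`: `X_l · β u_l = β(uᵢ − u_l)` for `l ∈ I∖i`. [OURS · L1 W4.5c] -/
theorem chartX_mul_beta_coreU (hi : i ∈ I) (β : CoreRing k p n →ₐ[k] ChartRing k p n i I)
    (hβi : β (coreU k p n i) = chartX k p n i I i)
    (hβI : ∀ l ∈ I.erase i, β (coreU k p n l) = chartX k p n i I i * (tI l)) (l : Fin n) (hl : l ∈ I.erase i) :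
    chartX k p n i I l * β (coreU k p n l) = β (coreU k p n i - coreU k p n l) := by
  have h1 := one_add_chartX_mul_tInv k p n i I hi l
  rw [map_sub, hβi, hβI l hl]
  linear_combination (chartX k p n i I i) * h1

/-- The dictionary entry of `e_l`: `X_l · β(uᵢ − u_l) = β u_l` for `l ∉ I`. [OURS · L1 W4.5c] -/
theorem chartX_mul_beta_coreDiff (hi : i ∈ I) (β : CoreRing k p n →ₐ[k] ChartRing k p n i I)
    (hβi : β (coreU k p n i) = chartX k p n i I i)
    (hβO : ∀ l ∉ I, β (coreU k p n l) = chartX k p n i I i * chartX k p n i I l * (tI l)) (l : Fin n)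
    (hl : l ∉ I) :
    chartX k p n i I l * β (coreU k p n i - coreU k p n l) = β (coreU k p n l) := by
  rw [beta_coreDiff k p n i I hi β hβi hβO l hl, hβO l hl]; ring

end Chart

end Summit.ResolutionOfSingularities.ResolutionOfSingularities.Theorems.WildQuotientResolution.ConductorOne

end
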